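import Literature.Analysis.Complex.LogDerivZerosDisc
import Literature.NumberTheory.LFunctions.ZetaLogDerivRH
import Mathlib.NumberTheory.Harmonic.ZetaAsymp
import HarnessLib

/-!
# `1/ζ` near the critical line at bounded height under RH: `|ζ(σ+it)|⁻¹ ≤ C (σ − ½)^{−M}`

Topic `Literature/NumberTheory/LFunctions`. A small-ordinate companion of the lower bounds for
`log|ζ(σ+it)|` at `V`-typical ordinates (Soundararajan 2009, Prop. 5; Balazard–de Roton,
arXiv:0810.3587, Props. 1, 19), which are stated for `t` large: in the Perron–contour argument for
`M(x)` (arXiv:0810.3587 §8.3, first vertical segment `Re z = ½ + 1/log N`, `|Im z| ≤ T_κ`) the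
bounded heights `|t| ≤ t₀` also need a bound for `|ζ(½ + 1/log N + it)|⁻¹`, polynomial in `log N`.
Under RH this is elementary: on the disc `|z − 2| ≤ t₀ + 2` write the entire function
`ζ₁(z) = (z−1)ζ(z)` as `P · G` with `P` the polynomial of its zeros there and `G` zero-free
(`Literature.Analysis.Complex.exists_eq_prod_pow_sub_mul`, Titchmarsh §3.9); the zeros are
non-trivial zeros of `ζ` (real part `½` under RH) or trivial zeros (real part `≤ −2`), so
`|P(σ+it)| ≥ (σ−½)^M` for `½ < σ ≤ 3/2`, while `|G| ≥ g₀ > 0` by compactness.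

Main result: `InvZetaSmallRH.exists_norm_inv_zeta_le_rpow_neg` — under RH, for every `t₀ ≥ 1`
there are `C > 0` and `M : ℕ` with `‖ζ(σ+it)⁻¹‖ ≤ C (σ − ½)^{−M}` for `½ < σ < 1`, `|t| ≤ t₀`.

## References

* E. C. Titchmarsh, *The Theory of the Riemann Zeta-Function*, 2nd ed. (1986), §3.9 Lemma α
  (dividing out the zeros). [cite: Titchmarsh1986, §3.9 Lemma α]
* [BalazardRoton2008] M. Balazard, A. de Roton, arXiv:0810.3587, §8.3 (where the bound is used).
-/

noncomputable section

open Complex Filter Set Metric MeromorphicOn Topology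

namespace Literature.NumberTheory.LFunctions

namespace InvZetaSmallRH

/-- A zero of `ζ₁(z) = (z−1)ζ(z)` is a zero of `ζ` different from `1`. [folklore] -/
lemma riemannZeta_eq_zero_of_riemannZeta₁_eq_zero {u : ℂ} (hu : riemannZeta₁ u = 0) :
    u ≠ 1 ∧ riemannZeta u = 0 := by
  have hu1 : u ≠ 1 := by
    rintro rfl
    rw [riemannZeta₁_one] at hu
    exact one_ne_zero hu
  refine ⟨hu1, ?_⟩
  rw [riemannZeta_eq_inv_sub_mul hu1, hu, mul_zero]

/-- Under RH, a zero `u` of `ζ₁` has `Re u = ½` or `Re u ≤ −2`. [folklore] -/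
lemma re_of_riemannZeta₁_eq_zero (hRH : RiemannHypothesis) {u : ℂ} (hu : riemannZeta₁ u = 0) :
    u.re = 1 / 2 ∨ u.re ≤ -2 := by
  obtain ⟨hu1, hζ⟩ := riemannZeta_eq_zero_of_riemannZeta₁_eq_zero hu
  by_cases htriv : ∃ n : ℕ, u = -2 * (n + 1)
  · obtain ⟨n, rfl⟩ := htriv
    right
    have : ((-2 : ℂ) * (n + 1)).re = -2 * (n + 1) := by simp
    rw [this]
    have hn : (0 : ℝ) ≤ n := n.cast_nonneg
    linarith
  · left
    exact hRH u hζ htriv hu1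

/-- For `½ < σ ≤ 3/2`, `|t| ≤ t₀` and a zero `u` of `ζ₁` (under RH): `σ − ½ ≤ |σ + it − u|`.
[folklore] -/
lemma sub_half_le_norm_sub (hRH : RiemannHypothesis) {u : ℂ} (hu : riemannZeta₁ u = 0) {σ t : ℝ}
    (hσ : 1 / 2 < σ) : σ - 1 / 2 ≤ ‖(σ : ℂ) + t * I - u‖ := by
  have hre := Complex.abs_re_le_norm ((σ : ℂ) + t * I - u)
  have e : ((σ : ℂ) + t * I - u).re = σ - u.re := by simp
  rw [e] at hre
  rcases re_of_riemannZeta₁_eq_zero hRH hu with h | h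
  · rw [h] at hre
    exact le_trans (le_abs_self _) hre
  · have : σ - 1 / 2 ≤ |σ - u.re| := by
      rw [abs_of_pos (by linarith)]; linarith
    exact this.trans hre

/-- **`|ζ(σ+it)|⁻¹ ≤ C(σ−½)^{−M}` at bounded height under RH.** For every `t₀ ≥ 1` there are `C > 0`
and `M : ℕ` such that `‖ζ(σ+it)⁻¹‖ ≤ C (σ − ½)^{−M}` whenever `½ < σ < 1` and `|t| ≤ t₀`.
[cite: Titchmarsh1986, §3.9 Lemma α] -/
theorem exists_norm_inv_zeta_le_rpow_neg (hRH : RiemannHypothesis) {t₀ : ℝ} (ht₀ : 1 ≤ t₀) :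
    ∃ C : ℝ, 0 < C ∧ ∃ M : ℕ, ∀ σ t : ℝ, 1 / 2 < σ → σ < 1 → |t| ≤ t₀ →
      ‖(riemannZeta (σ + t * I))⁻¹‖ ≤ C * (σ - 1 / 2) ^ (-(M : ℝ)) := by
  classical
  -- divide out the zeros of `ζ₁` on the disc `|z − 2| ≤ t₀ + 2`
  set c : ℂ := 2 with hc
  set R : ℝ := t₀ + 2 with hR
  have hR0 : 0 < R := by rw [hR]; linarith
  have hfan : AnalyticOnNhd ℂ riemannZeta₁ (closedBall c R) := fun z _ ↦
    differentiable_riemannZeta₁.analyticAt z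
  have hfc : riemannZeta₁ c ≠ 0 := by
    rw [hc]
    intro h0
    obtain ⟨-, hζ⟩ := riemannZeta_eq_zero_of_riemannZeta₁_eq_zero h0
    exact riemannZeta_ne_zero_of_one_lt_re (by norm_num) hζ
  obtain ⟨G, hGan, hGne, hfact⟩ :=
    Literature.Analysis.Complex.exists_eq_prod_pow_sub_mul hR0 le_rfl hfan hfc
  set D := divisor riemannZeta₁ (closedBall c R) with hD
  set S := (D.finiteSupport (isCompact_closedBall c R)).toFinset with hS
  set M : ℕ := ∑ u ∈ S, (D u).toNat with hM
  -- every `u ∈ S` is a zero of `ζ₁`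
  have hzero : ∀ u ∈ S, riemannZeta₁ u = 0 := by
    intro u hu
    rw [hS, Set.Finite.mem_toFinset] at hu
    have hsupp : D u ≠ 0 := hu
    have huU : u ∈ closedBall c R := D.supportWithinDomain hu
    by_contra hne
    apply hsupp
    rw [hD, divisor_apply (hfan.meromorphicOn) huU, (hfan u huU).meromorphicOrderAt_eq,
      ((hfan u huU).analyticOrderAt_eq_zero.2 hne)]
    simp
  -- `|G| ≥ g₀ > 0` on the compact disc
  obtain ⟨g₀, hg₀0, hg₀⟩ : ∃ g₀ : ℝ, 0 < g₀ ∧ ∀ z ∈ closedBall c R, g₀ ≤ ‖G z‖ := by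
    have hcont : ContinuousOn (fun z ↦ ‖G z‖) (closedBall c R) :=
      continuous_norm.comp_continuousOn hGan.continuousOn
    obtain ⟨z₀, hz₀, hmin⟩ := (isCompact_closedBall c R).exists_isMinOn
      (nonempty_closedBall.2 hR0.le) hcont
    refine ⟨‖G z₀‖, norm_pos_iff.2 (hGne z₀ hz₀), fun z hz ↦ ?_⟩
    exact hmin hz
  -- the bound
  refine ⟨(t₀ + 3) / g₀, by positivity, M, fun σ t hσ hσ1 ht ↦ ?_⟩
  set z : ℂ := σ + t * I with hz
  have hzmem : z ∈ closedBall c R := by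
    rw [mem_closedBall, dist_eq_norm, hz, hc, hR]
    have h1 : ‖(σ : ℂ) + t * I - 2‖ ≤ |σ - 2| + |t| := by
      have := norm_add_le (((σ - 2 : ℝ)) : ℂ) ((t : ℂ) * I)
      simp only [Complex.norm_real, Real.norm_eq_abs, norm_mul, Complex.norm_I, mul_one] at this
      have e : (((σ - 2 : ℝ)) : ℂ) + (t : ℂ) * I = (σ : ℂ) + t * I - 2 := by push_cast; ring
      rw [e] at this; exact this
    have h2 : |σ - 2| ≤ 2 := by rw [abs_le]; constructor <;> linarith
    linarith
  have hz1 : z ≠ 1 := fun h ↦ by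
    have := congrArg Complex.re h
    simp [hz] at this
    linarith
  -- `ζ(z)⁻¹ = (z − 1)/ζ₁(z)`
  have hζ₁ : riemannZeta z = (z - 1)⁻¹ * riemannZeta₁ z := riemannZeta_eq_inv_sub_mul hz1
  have hP : (σ - 1 / 2) ^ M ≤ ‖∏ u ∈ S, (z - u) ^ (D u).toNat‖ := by
    rw [norm_prod, hM, ← Finset.prod_pow_eq_pow_sum]
    refine Finset.prod_le_prod (fun u _ ↦ by positivity) fun u hu ↦ ?_
    rw [norm_pow]
    exact pow_le_pow_left₀ (by linarith) (sub_half_le_norm_sub hRH (hzero u hu) hσ) _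
  have hσpos : 0 < σ - 1 / 2 := by linarith
  have hPpos : 0 < (σ - 1 / 2) ^ M := pow_pos hσpos M
  have hfz := hfact z hzmem
  have hζ₁norm : (σ - 1 / 2) ^ M * g₀ ≤ ‖riemannZeta₁ z‖ := by
    rw [hfz, norm_mul]
    exact mul_le_mul hP (hg₀ z hzmem) hg₀0.le (norm_nonneg _)
  have hζ₁ne : riemannZeta₁ z ≠ 0 := by
    intro h0
    rw [h0, norm_zero] at hζ₁norm
    have : 0 < (σ - 1 / 2) ^ M * g₀ := mul_pos hPpos hg₀0
    linarith
  have hz1norm : ‖z - 1‖ ≤ t₀ + 3 := by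
    rw [hz]
    have := norm_add_le (((σ - 1 : ℝ)) : ℂ) ((t : ℂ) * I)
    simp only [Complex.norm_real, Real.norm_eq_abs, norm_mul, Complex.norm_I, mul_one] at this
    have e : (((σ - 1 : ℝ)) : ℂ) + (t : ℂ) * I = (σ : ℂ) + t * I - 1 := by push_cast; ring
    rw [e] at this
    have h2 : |σ - 1| ≤ 1 := by rw [abs_le]; constructor <;> linarith
    linarith
  rw [hζ₁, mul_inv, inv_inv, norm_mul, Real.rpow_neg hσpos.le, Real.rpow_natCast]
  calc ‖z - 1‖ * ‖(riemannZeta₁ z)⁻¹‖ ≤ (t₀ + 3) * ((σ - 1 / 2) ^ M * g₀)⁻¹ := by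
        rw [norm_inv]
        exact mul_le_mul hz1norm ((inv_le_inv₀ (norm_pos_iff.2 hζ₁ne) (mul_pos hPpos hg₀0)).2 hζ₁norm)
          (by positivity) (by positivity)
    _ = (t₀ + 3) / g₀ * ((σ - 1 / 2) ^ M)⁻¹ := by
        field_simp

end InvZetaSmallRH

end Literature.NumberTheory.LFunctions

end
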